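import Literature.AnabelianGeometry.EtaleTheta.TemperedFrobenioidUnitToy
import HarnessLib

/-!
# [EtTh] Def. 3.6 AS TYPED: the self-equivalence `Ψ ≅ 𝟭` induced by a UNIT of the divisor monoid, and the
# hull of `UnitToy.frdFull` (toy data, part 2)

S. Mochizuki, *The étale theta function …*, Publ. RIMS **45** (2009) [EtTh], Def. 3.6 (ii)/(iv) PDF pp. 77–78, Cor. 3.8
PDF pp. 80–82 [cite: MochizukiEtTh2009, Def 3.6 p.77] [cite: MochizukiEtTh2009, Cor 3.8 p.80]; [FrdI] Thm. 5.2 (i)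
p. 100 [cite: MochizukiFrdI2008, Thm. 5.2(i) p.100]. abc-iut cell, block F, seat abc-iut-f-135; DATA file, sequel of
`TemperedFrobenioidUnitToy.lean`, behind the schema verdicts of `TemperedFrobenioidCor38SubUnitNegative.lean`
(FACT-LIST F-2818, F-2821; second witness for F-2823).

WHAT IS BUILT. (1) On `C := UnitToy.frdFull.category` (Φ = ℤ × ℕ with the unit `n₀ = (1,0)`): the arrows
`(1, id, n₀, 1) : (A, α) → (A, α + n₀)` are ISOMORPHISMS with NONZERO zero divisor (`shiftIso`); conjugating by them is a
functor `shiftFunctor ≅ 𝟭` and the self-equivalence `shiftEquiv` (`Equivalence.refl.changeFunctor`), whence the Cor. 3.8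
data AS TYPED `hypShift : Cor38Hyp frdFull frdFull`. (2) In the base-field-theoretic hull of `frdFull` (`F₀^Λ = ℤ`)
any two objects over `pt` are isomorphic (`hullIso`: the pre-step `(1, id, 0, (b, ξ/ξ'))` with the constant function
`b = deg(ξ/ξ') ∈ ℤ`). HONEST FRAMING: degenerate typed-interface data; nothing here bears on [IUTchIII] Cor. 3.12.
-/

noncomputable section

namespace Literature.AnabelianGeometry.EtaleTheta

open CategoryTheory Opposite Literature.AlgebraicGeometry.Frobenioids

namespace UnitToy

/-! ## The unit `n₀ = (1,0) ∈ Φ` and the self-equivalence `Ψ ≅ 𝟭` it induces on `C = frdFull.category` -/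

/-- `n₀ ∈ Φ(A) = ℤ × ℕ`. [cite: MochizukiEtTh2009, Def 3.6 p.77] -/
def n₀Φ (A : (Discrete PUnit.{1})ᵒᵖ) : (frdFull.divisorMonoid.obj A : Type) :=
  (⟨n₀, Submonoid.mem_top n₀⟩ : ↥(⊤ : Submonoid M))

/-- `n₀⁻¹ ∈ Φ(A)`. [cite: MochizukiEtTh2009, Def 3.6 p.77] -/
def n₀invΦ (A : (Discrete PUnit.{1})ᵒᵖ) : (frdFull.divisorMonoid.obj A : Type) :=
  (⟨n₀inv, Submonoid.mem_top n₀inv⟩ : ↥(⊤ : Submonoid M))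

/-- `n₀ · n₀⁻¹ = 1` in `Φ(A)`. [cite: MochizukiEtTh2009, Def 3.6 p.77] -/
@[simp] theorem n₀Φ_mul_n₀invΦ (A : (Discrete PUnit.{1})ᵒᵖ) : n₀Φ A * n₀invΦ A = 1 :=
  Subtype.ext (show n₀ * n₀inv = 1 from rfl)

/-- `n₀⁻¹ · n₀ = 1` in `Φ(A)`. [cite: MochizukiEtTh2009, Def 3.6 p.77] -/
@[simp] theorem n₀invΦ_mul_n₀Φ (A : (Discrete PUnit.{1})ᵒᵖ) : n₀invΦ A * n₀Φ A = 1 :=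
  Subtype.ext (show n₀inv * n₀ = 1 from rfl)

/-- `n₀⁻¹ ≠ 1`: `Φ = ℤ × ℕ` is NOT sharp. [cite: MochizukiEtTh2009, Def 3.6 p.77] -/
theorem n₀invΦ_ne_one (A : (Discrete PUnit.{1})ᵒᵖ) : n₀invΦ A ≠ 1 := by
  intro h
  have h' := congrArg (fun z : (frdFull.divisorMonoid.obj A : Type) => Multiplicative.toAdd z.1.1) h
  change Multiplicative.toAdd (Multiplicative.ofAdd (-1 : ℤ)) = Multiplicative.toAdd (1 : Multiplicative ℤ) at h'
  simp at h'

/-- The pull-back of `Φ` along an identity is the identity (bookkeeping). [cite: MochizukiEtTh2009, Def 3.6 p.77] -/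
theorem divisorMonoid_map_id_apply (A : Discrete PUnit.{1}) (x : (frdFull.divisorMonoid.obj (op A) : Type)) :
    (frdFull.divisorMonoid.map (𝟙 A).op).hom x = x := by
  rw [op_id, frdFull.divisorMonoid.map_id]; rfl

/-- The object `(A, α + n₀)`. [cite: MochizukiEtTh2009, Def 3.6 p.77] -/
abbrev shiftObj (X : frdFull.category) : frdFull.category :=
  ⟨X.base, X.cls * Algebra.GrothendieckGroup.of (n₀Φ (op X.base))⟩

/-- The isomorphism `(1, id, n₀, 1) : (A, α) → (A, α + n₀)` — an ISOMORPHISM with NONZERO zero divisor (possible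
exactly because `Φ` has the unit `n₀`). [cite: MochizukiEtTh2009, Def 3.6 p.77] -/
def shiftHom (X : frdFull.category) : X ⟶ shiftObj X where
  degFr := 1
  base := 𝟙 _
  div := n₀Φ _
  unit := 1
  rel := by
    change X.cls ^ ((1 : ℕ+) : ℕ) * Algebra.GrothendieckGroup.of (n₀Φ _) =
      pullGp frdFull.divisorMonoid (𝟙 X.base) (X.cls * Algebra.GrothendieckGroup.of (n₀Φ _)) * _
    rw [PNat.one_coe, pow_one, pullGp_id, map_one, mul_one]

/-- Its inverse `(1, id, n₀⁻¹, 1)`. [cite: MochizukiEtTh2009, Def 3.6 p.77] -/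
def shiftInv (X : frdFull.category) : shiftObj X ⟶ X where
  degFr := 1
  base := 𝟙 _
  div := n₀invΦ _
  unit := 1
  rel := by
    change (X.cls * Algebra.GrothendieckGroup.of (n₀Φ _)) ^ ((1 : ℕ+) : ℕ) *
        Algebra.GrothendieckGroup.of (n₀invΦ _) = pullGp frdFull.divisorMonoid (𝟙 X.base) X.cls * _
    rw [PNat.one_coe, pow_one, pullGp_id, map_one, mul_one, mul_assoc, ← map_mul, n₀Φ_mul_n₀invΦ, map_one,
      mul_one]

/-- `(1,id,n₀,1) ≫ (1,id,n₀⁻¹,1) = id`. [cite: MochizukiFrdI2008, Thm. 5.2(i) p.100] -/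
theorem shiftHom_shiftInv (X : frdFull.category) : shiftHom X ≫ shiftInv X = 𝟙 X := by
  apply ModelFrobenioid.hom_ext
  · rfl
  · exact Subsingleton.elim _ _
  · change (frdFull.divisorMonoid.map (𝟙 X.base).op).hom (n₀invΦ _) * n₀Φ _ ^ ((1 : ℕ+) : ℕ) = 1
    rw [divisorMonoid_map_id_apply, PNat.one_coe, pow_one, n₀invΦ_mul_n₀Φ]
  · change (frdFull.ratFnFunctor.map (𝟙 X.base).op).hom 1 * 1 ^ ((1 : ℕ+) : ℕ) = 1
    rw [map_one, one_pow, mul_one]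

/-- `(1,id,n₀⁻¹,1) ≫ (1,id,n₀,1) = id`. [cite: MochizukiFrdI2008, Thm. 5.2(i) p.100] -/
theorem shiftInv_shiftHom (X : frdFull.category) : shiftInv X ≫ shiftHom X = 𝟙 (shiftObj X) := by
  apply ModelFrobenioid.hom_ext
  · rfl
  · exact Subsingleton.elim _ _
  · change (frdFull.divisorMonoid.map (𝟙 X.base).op).hom (n₀Φ _) * n₀invΦ _ ^ ((1 : ℕ+) : ℕ) = 1
    rw [divisorMonoid_map_id_apply, PNat.one_coe, pow_one, n₀Φ_mul_n₀invΦ]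
  · change (frdFull.ratFnFunctor.map (𝟙 X.base).op).hom 1 * 1 ^ ((1 : ℕ+) : ℕ) = 1
    rw [map_one, one_pow, mul_one]

/-- `(A, α) ≅ (A, α + n₀)`. [cite: MochizukiEtTh2009, Def 3.6 p.77] -/
def shiftIso (X : frdFull.category) : X ≅ shiftObj X :=
  ⟨shiftHom X, shiftInv X, shiftHom_shiftInv X, shiftInv_shiftHom X⟩

/-- Conjugation by the `shiftIso`: a functor `C → C`. [cite: MochizukiEtTh2009, Cor 3.8 p.80] -/
def shiftFunctor : frdFull.category ⥤ frdFull.category where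
  obj := shiftObj
  map {X Y} φ := (shiftIso X).inv ≫ φ ≫ (shiftIso Y).hom
  map_id X := by simp
  map_comp φ ψ := by simp

/-- `𝟭 ≅ shiftFunctor`. [cite: MochizukiEtTh2009, Cor 3.8 p.80] -/
def shiftNatIso : 𝟭 frdFull.category ≅ shiftFunctor :=
  NatIso.ofComponents shiftIso (fun φ => by simp [shiftFunctor])

/-- **The self-equivalence `Ψ` of `C`** (`≅ 𝟭`, with `Ψ(A, α) = (A, α + n₀)`). [cite: MochizukiEtTh2009, Cor 3.8 p.80] -/
def shiftEquiv : frdFull.category ≌ frdFull.category :=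
  (CategoryTheory.Equivalence.refl (C := frdFull.category)).changeFunctor shiftNatIso

/-- The functor of `shiftEquiv` is the conjugation functor (definitionally). [cite: MochizukiEtTh2009, Def 3.6 p.77] -/
theorem shiftEquiv_functor : shiftEquiv.functor = shiftFunctor := rfl

/-- **The data of Cor. 3.8 AS TYPED, first witness**: `C₁ = C₂ = C`, `Ψ` the shift self-equivalence, `D = pt` of
FSMFF-type, "non-dilating" the (trivial) vocabulary clause. [cite: MochizukiEtTh2009, Cor 3.8 p.80] -/
def hypShift : Cor38Hyp frdFull frdFull :=
  ⟨shiftEquiv, ⟨ArchFrd.isOfFSMFFType_discretePUnit, ArchFrd.isOfFSMFFType_discretePUnit⟩,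
    ⟨fun _ _ => trivial, fun _ _ => trivial⟩⟩

/-- The zero object `(•, 0)` of `C` ([FrdI] Thm. 5.2 proof). [cite: MochizukiFrdI2008, Thm. 5.2 p.101] -/
abbrev A0 : frdFull.category := ModelFrobenioid.zeroObj _ _ _ pt

/-! ## The hull of `frdFull` is connected by isomorphisms -/

/-- `Div_F(u) = ξ` for `u = (b, ξ) ∈ F^{bs}` (bookkeeping). [cite: MochizukiEtTh2009, Def 3.6 p.78] -/
theorem divF_apply (F : Submonoid (Multiplicative ℤ)) (hF : Multiplicative.ofAdd (1 : ℤ) ∈ F)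
    (A : (Discrete PUnit.{1})ᵒᵖ) (u : ((frd F hF).cnstFnBsFunctor.obj A : Type)) :
    divB (frd F hF).bsFldMonoid (frd F hF).cnstFnBsFunctor (frd F hF).divFNatTrans A u = u.1.2 := rfl

/-- The `ℕ`-coordinate `(Φ^{bs-fld})^gp = (0 × ℕ)^gp → ℤ` of the hull of `frdFull` (bookkeeping). [cite: MochizukiEtTh2009, Def 3.6 p.78] -/
def degBs : Algebra.GrothendieckGroup (frdFull.bsFldMonoid.obj (op pt) : Type) →* Multiplicative ℤ :=
  Algebra.GrothendieckGroup.lift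
    ((AddMonoidHom.toMultiplicative (Nat.castAddMonoidHom ℤ)).comp
      ((MonoidHom.snd (Multiplicative ℤ) (Multiplicative ℕ)).comp (frdFull.bsFld.carrier (op pt)).subtype))

/-- `div ∘ degBs = ι` on `(Φ^{bs-fld})^gp`: every class of `(Φ^{bs-fld})^gp` is the divisor of a (constant) rational
function when `F₀^Λ = ℤ`. [cite: MochizukiEtTh2009, Def 3.6 p.78] -/
theorem divHom_degBs (ξ : Algebra.GrothendieckGroup (frdFull.bsFldMonoid.obj (op pt) : Type)) :
    divHom (degBs ξ) = frdFull.bsFldGpToRlog (op pt) ξ := by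
  suffices h : divHom.comp degBs = frdFull.bsFldGpToRlog (op pt) from DFunLike.congr_fun h ξ
  refine MonGp.hom_ext fun x => ?_
  have hx1 : x.1.1 = 1 := (mem_bs_iff _ _ _ x.1).1 x.2
  have hx : (x.1 : M) = x₁ ^ (Multiplicative.toAdd x.1.2 : ℕ) := by
    refine Prod.ext ?_ ?_
    · change x.1.1 = (1 : Multiplicative ℤ) ^ (Multiplicative.toAdd x.1.2 : ℕ)
      rw [one_pow, hx1]
    · change x.1.2 = Multiplicative.ofAdd (1 : ℕ) ^ (Multiplicative.toAdd x.1.2 : ℕ)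
      rw [← ofAdd_nsmul, smul_eq_mul, mul_one, ofAdd_toAdd]
  change divHom (degBs (Algebra.GrothendieckGroup.of x)) = gpMap (Submonoid.subtype _) (Algebra.GrothendieckGroup.of x)
  rw [degBs, lift_of, gpMap_of, divHom_apply]
  change Algebra.GrothendieckGroup.of x₁ ^ (Multiplicative.toAdd (Multiplicative.ofAdd
      ((Multiplicative.toAdd x.1.2 : ℕ) : ℤ))) = Algebra.GrothendieckGroup.of (x.1 : M)
  rw [toAdd_ofAdd, zpow_natCast, ← map_pow, ← hx]
  rfl

/-- The constant rational function `(b, ξ/ξ')` of the hull of `frdFull`. [cite: MochizukiEtTh2009, Def 3.6 p.78] -/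
def hullUnit (c c' : Algebra.GrothendieckGroup (frdFull.bsFldMonoid.obj (op pt) : Type)) :
    (frdFull.cnstFnBsFunctor.obj (op pt) : Type) :=
  (⟨(degBs (c * c'⁻¹), c * c'⁻¹), ⟨Submonoid.mem_top _, divHom_degBs _⟩⟩ : ↥(frdFull.cnstFnBs (op pt)))

/-- The pre-step `(1, id, 0, (b, ξ/ξ')) : (•, ξ) → (•, ξ')` of the hull of `frdFull`. [cite: MochizukiEtTh2009, Def 3.6 p.78] -/
def hullHom (c c' : Algebra.GrothendieckGroup (frdFull.bsFldMonoid.obj (op pt) : Type)) :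
    (⟨pt, c⟩ : frdFull.hullCategory) ⟶ ⟨pt, c'⟩ where
  degFr := 1
  base := 𝟙 pt
  div := 1
  unit := hullUnit c c'
  rel := by
    rw [PNat.one_coe, pow_one, map_one, mul_one, pullGp_id, divF_apply]
    change c = c' * (c * c'⁻¹)
    rw [mul_comm c c'⁻¹, mul_inv_cancel_left]

/-- The pre-steps `hullHom` compose. [cite: MochizukiFrdI2008, Thm. 5.2(i) p.100] -/
theorem hullHom_comp (c c' c'' : Algebra.GrothendieckGroup (frdFull.bsFldMonoid.obj (op pt) : Type)) :
    hullHom c c' ≫ hullHom c' c'' = hullHom c c'' := by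
  apply ModelFrobenioid.hom_ext
  · rfl
  · exact Subsingleton.elim _ _
  · change (frdFull.bsFldMonoid.map (𝟙 pt).op).hom 1 * 1 ^ ((1 : ℕ+) : ℕ) = 1
    rw [map_one, one_pow, mul_one]
  · change (frdFull.cnstFnBsFunctor.map (𝟙 pt).op).hom (hullUnit c' c'') * hullUnit c c' ^ ((1 : ℕ+) : ℕ) =
      hullUnit c c''
    rw [op_id, frdFull.cnstFnBsFunctor.map_id, CommMonCat.hom_id, MonoidHom.id_apply, PNat.one_coe, pow_one]
    apply Subtype.ext
    refine Prod.ext ?_ ?_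
    · change degBs (c' * c''⁻¹) * degBs (c * c'⁻¹) = degBs (c * c''⁻¹)
      rw [← map_mul, mul_comm, mul_assoc, inv_mul_cancel_left]
    · change (c' * c''⁻¹) * (c * c'⁻¹) = c * c''⁻¹
      rw [mul_comm, mul_assoc, inv_mul_cancel_left]

/-- `hullHom c c = id`. [cite: MochizukiFrdI2008, Thm. 5.2(i) p.100] -/
theorem hullHom_self (c : Algebra.GrothendieckGroup (frdFull.bsFldMonoid.obj (op pt) : Type)) :
    hullHom c c = 𝟙 (⟨pt, c⟩ : frdFull.hullCategory) := by
  apply ModelFrobenioid.hom_ext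
  · rfl
  · rfl
  · rfl
  · change hullUnit c c = 1
    apply Subtype.ext
    refine Prod.ext ?_ ?_
    · change degBs (c * c⁻¹) = 1
      rw [mul_inv_cancel, map_one]
    · change c * c⁻¹ = 1
      exact mul_inv_cancel c

/-- In the hull of `frdFull` (`F₀^Λ = ℤ`) ALL objects are isomorphic. [cite: MochizukiEtTh2009, Def 3.6 p.78] -/
def hullIso (c c' : Algebra.GrothendieckGroup (frdFull.bsFldMonoid.obj (op pt) : Type)) :
    (⟨pt, c⟩ : frdFull.hullCategory) ≅ ⟨pt, c'⟩ :=
  ⟨hullHom c c', hullHom c' c, by rw [hullHom_comp, hullHom_self], by rw [hullHom_comp, hullHom_self]⟩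

end UnitToy

end Literature.AnabelianGeometry.EtaleTheta

end
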